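import Summits.ValiantsHypothesis.ValiantsHypothesis.Theorems.DivisionGapPerDivisionHardStubSparseRigidFlow
import Summits.ValiantsHypothesis.ValiantsHypothesis.Theorems.DivisionGapPerDivisionHardCutsOutDiag

/-!
# Crux `DivisionGap.PerDivisionHard` (stmt-ValiantsHypothesis-5065), line `pair-descent-jss-endpoint`
(skeleton v13) — stub `stub_altFlow`: alternation detects circulations

The block arsenal `G(b,k) ⊕ M₀` (`BlockV`, `blockAdj`, `placedBlock` of
`Theorems/DivisionGapDefs.lean`) is `K_{b,b}` with every core edge `(i, j)` subdivided into the
path  row `i` — col `(i,j,0)` — row `(i,j,0)` — col `(i,j,1)` — … — row `(i,j,k-1)` — col `j`,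
padded by a perfect matching; circulations (integer functions on (row label, column label) pairs
supported on edges with vanishing row and column sums) and their path structure come from
`Theorems/DivisionGapPerDivisionHardStubSparseRigidFlow.lean` (`flow_path`, `pathVal`, …).

Suppose a set of rows ALTERNATES along every path: the internal row `(i, j, t)` is selected iff
`t` is even.  `altFlow_colSum_ne_zero`: if the path `(i, j)` has nonzero path value `a`, then the
selected-column-sum of each later internal column `(i, j, t+1)` is `± a ≠ 0` — that column meets
exactly the rows `(i, j, t)` (value `a`) and `(i, j, t+1)` (value `-a`) (`flow_path`,
`adj_internalCol`), exactly one of which is selected.  `altFlow_paddingCol_eq_zero`: a circulation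
vanishes on padding columns (a padding column meets only its padding row, `adj_paddingCol` of
`Theorems/DivisionGapPerDivisionHardCutsOutDiag.lean`, where circulations vanish,
`flow_padding_eq_zero`).  Transported to a placement
`eR eC : BlockV b k m ≃ Fin n` this is the registered stub `stub_altFlow`: for a nonzero integer
matrix `D` supported on the placed graph with vanishing row and column sums and a row set `A` with
`eR (i, j, t) ∈ A ↔ t` even, the `A`-column-sums `c ↦ Σ_{r ∈ A} D (r, c)` are nonzero on at least
`k - 1` columns (the columns `eC (i, j, 1), …, eC (i, j, k-1)` of a path with nonzero path value,
`exists_pathVal_ne_zero`), and every column with nonzero `A`-column-sum is not a padding column.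
-/

noncomputable section

-- `Summit.ValiantsHypothesis.ValiantsHypothesis.…` is the tree's mandated single-conjunct layout
-- (Sub = Summit), so the duplicated namespace component is intended.
set_option linter.dupNamespace false

namespace Summit.ValiantsHypothesis.ValiantsHypothesis.Theorems.DivisionGapPerDivisionHard

open MvPolynomial Literature.Computability.AlgebraicComplexity
open Summit.ValiantsHypothesis.ValiantsHypothesis.Theorems.ZeroOneTransfer.Negative
open scoped NNReal

variable {b k m : ℕ}

section Flow

variable {F : BlockV b k m → BlockV b k m → ℤ}
variable (hF : (∀ r ℓ, F r ℓ ≠ 0 → blockAdj b k m r ℓ = true) ∧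
    (∀ r, ∑ ℓ, F r ℓ = 0) ∧ ∀ ℓ, ∑ r, F r ℓ = 0)
include hF

/-- A circulation vanishes on padding columns. [folklore] -/
theorem altFlow_paddingCol_eq_zero (r : BlockV b k m) (u : Fin m) :
    F r (Sum.inr (Sum.inr u)) = 0 := by
  by_contra h0
  have hr := adj_paddingCol (hF.1 _ _ h0)
  subst hr
  exact h0 (flow_padding_eq_zero hF u _)

/-- **Alternation detects a path.**  If the rows selected by `p` alternate along the paths (the
internal row `(i, j, t)` is selected iff `t` is even) and the path `(i, j)` has nonzero path
value `a`, then the `p`-column-sum of every later internal column `(i, j, t+1)` of that path is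
nonzero: the column meets exactly the rows `(i, j, t)` (value `a`) and `(i, j, t+1)` (value `-a`),
exactly one of which is selected. [folklore] -/
theorem altFlow_colSum_ne_zero (hk : 0 < k) (p : BlockV b k m → Prop) [DecidablePred p]
    (halt : ∀ (i j : Fin b) (t : Fin k), p (iv i j t) ↔ (t : ℕ) % 2 = 0) {i j : Fin b}
    (hij : pathVal F hk i j ≠ 0) (t : ℕ) (ht : t + 1 < k) :
    (∑ x, if p x then F x (iv i j ⟨t + 1, ht⟩) else 0) ≠ 0 := by
  have ht0 : t < k := Nat.lt_of_succ_lt ht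
  -- the values at the two rows adjacent to the column `(i, j, t+1)`
  have h1 : F (iv i j ⟨t + 1, ht⟩) (iv i j ⟨t + 1, ht⟩) = -pathVal F hk i j :=
    (flow_path hF hk i j (t + 1) ht).1
  have h0 : F (iv i j ⟨t, ht0⟩) (iv i j ⟨t + 1, ht⟩) = pathVal F hk i j := by
    have := (flow_path hF hk i j t ht0).2
    rwa [nextCol_of_lt i j t ht] at this
  have hne : (iv i j ⟨t + 1, ht⟩ : BlockV b k m) ≠ iv i j ⟨t, ht0⟩ := fun h => by
    have := Fin.mk.inj (Prod.mk.inj (Prod.mk.inj (Sum.inl.inj (Sum.inr.inj h))).2).2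
    omega
  -- the nonzero terms of the column sum sit at these two rows
  have hsupp : ∀ x, (if p x then F x (iv i j ⟨t + 1, ht⟩) else 0) ≠ 0 →
      x = iv i j ⟨t + 1, ht⟩ ∨ x = iv i j ⟨t, ht0⟩ := by
    intro x hx
    have hx' : F x (iv i j ⟨t + 1, ht⟩) ≠ 0 := fun h => hx (by simp [h])
    rcases adj_internalCol (hF.1 _ _ hx') with h | h
    · exact Or.inl h
    · exact Or.inr (h.trans (prevRow_succ i j t ht))
  rw [sum_eq_of_ne_zero_imp_or _ _ _ hne hsupp]
  -- exactly one of the two rows is selected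
  have hp1 : p (iv i j ⟨t + 1, ht⟩) ↔ (t + 1) % 2 = 0 := halt i j ⟨t + 1, ht⟩
  have hp0 : p (iv i j ⟨t, ht0⟩) ↔ t % 2 = 0 := halt i j ⟨t, ht0⟩
  by_cases hpar : t % 2 = 0
  · have hn1 : ¬p (iv i j ⟨t + 1, ht⟩) := by
      rw [hp1]
      omega
    rw [if_neg hn1, if_pos (hp0.mpr hpar), h0, zero_add]
    exact hij
  · have hy1 : p (iv i j ⟨t + 1, ht⟩) := by
      rw [hp1]
      omega
    rw [if_pos hy1, if_neg (fun h => hpar (hp0.mp h)), h1, add_zero, neg_ne_zero]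
    exact hij

end Flow

/-- **`stub_altFlow` (registered sub-goal of the line, skeleton v13): alternation detects
circulations.**  Let `D` be an integer matrix supported on a placed block graph
`placedBlock eR eC` (`k ≥ 1`) with vanishing row and column sums, and let the internal rows of
every path alternate with respect to the row set `A` (`eR (i, j, t) ∈ A ↔ t` even).  If `D ≠ 0`
then (i) at least `k - 1` columns `c` have a nonzero `A`-column-sum `Σ_{r ∈ A} D (r, c)` (the
columns `eC (i, j, 1), …, eC (i, j, k-1)` of a path `(i, j)` with nonzero path value, by
`altFlow_colSum_ne_zero`), and (ii) a column with nonzero `A`-column-sum is not a padding column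
(`altFlow_paddingCol_eq_zero`). [folklore] -/
theorem stub_altFlow :
    ∀ (b k m n : ℕ) (eR eC : BlockV b k m ≃ Fin n) (A : Finset (Fin n)) (D : Fin n × Fin n → ℤ), 0 < k →
      (∀ e, D e ≠ 0 → e ∈ placedBlock eR eC) → (∀ r, ∑ c, D (r, c) = 0) → (∀ c, ∑ r, D (r, c) = 0) →
      (∀ (i j : Fin b) (t : Fin k), eR (Sum.inr (Sum.inl (i, j, t))) ∈ A ↔ (t : ℕ) % 2 = 0) →
      (∃ e, D e ≠ 0) →
      k - 1 ≤ (Finset.univ.filter fun c : Fin n => ∑ r ∈ A, D (r, c) ≠ 0).card ∧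
        ∀ (c : Fin n) (u : Fin m), ∑ r ∈ A, D (r, c) ≠ 0 → eC.symm c ≠ Sum.inr (Sum.inr u) := by
  intro b k m n eR eC A D hk hG hrow hcol halt hne
  have hF := labelFlow_of_placed eR eC hG hrow hcol
  refine ⟨?_, fun c u hsum hu => hsum (Finset.sum_eq_zero fun r _ => ?_)⟩
  · -- (i) `k - 1` columns with nonzero `A`-column-sum
    obtain ⟨⟨r₀, c₀⟩, h₀⟩ := hne
    have hne' : ∃ r ℓ, (fun r ℓ => D (eR r, eC ℓ)) r ℓ ≠ 0 :=
      ⟨eR.symm r₀, eC.symm c₀, by simpa using h₀⟩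
    obtain ⟨r, ℓ, h⟩ := hne'
    obtain ⟨i, j, hij⟩ := exists_pathVal_ne_zero hF hk h
    -- the `A`-column-sum of a placed column, in label coordinates
    have hcolSum : ∀ ℓ : BlockV b k m,
        ∑ r ∈ A, D (r, eC ℓ) = ∑ x, if eR x ∈ A then D (eR x, eC ℓ) else 0 := by
      intro ℓ
      rw [Equiv.sum_comp eR (fun r => if r ∈ A then D (r, eC ℓ) else 0), Finset.sum_ite_mem_eq]
    have hmem : ∀ (t : ℕ) (ht : t + 1 < k), eC (iv i j ⟨t + 1, ht⟩) ∈
        Finset.univ.filter fun c : Fin n => ∑ r ∈ A, D (r, c) ≠ 0 := by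
      intro t ht
      rw [Finset.mem_filter, hcolSum]
      exact ⟨Finset.mem_univ _, altFlow_colSum_ne_zero hF hk (fun x => eR x ∈ A) halt hij t ht⟩
    -- the `k - 1` later internal columns of the path `(i, j)` are distinct
    let φ : Fin (k - 1) → Fin n := fun s => eC (iv i j ⟨(s : ℕ) + 1, by omega⟩)
    have hinj : Function.Injective φ := by
      intro s₁ s₂ hs
      have := Fin.mk.inj
        (Prod.mk.inj (Prod.mk.inj (Sum.inl.inj (Sum.inr.inj (eC.injective hs)))).2).2
      exact Fin.ext (by omega)
    calc k - 1 = (Finset.univ : Finset (Fin (k - 1))).card := (Finset.card_fin _).symm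
      _ ≤ (Finset.univ.filter fun c : Fin n => ∑ r ∈ A, D (r, c) ≠ 0).card :=
        Finset.card_le_card_of_injOn φ (fun s _ => hmem s (by omega)) hinj.injOn
  · -- (ii) a padding column carries only zeros
    have h0 := altFlow_paddingCol_eq_zero hF (eR.symm r) u
    rw [← hu] at h0
    simpa using h0

end Summit.ValiantsHypothesis.ValiantsHypothesis.Theorems.DivisionGapPerDivisionHard

end
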